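import Literature.MathematicalPhysics.QuantumFieldTheory.Balaban1983to89.B16Sect1Statements

/-!
# `Balaban1983to89.B16Ineq141Solution` — T. Bałaban, *Large field renormalization. II. Localization, exponentiation, and
bounds for the 𝐑 operation*, Commun. Math. Phys. **122** (1989) 355–392 [Balaban1989LargeFieldII], Sect. 1 p. 367:
the sentence after (1.40) — *"Eq. (1.40) has exactly one solution B′_Λ(B̃′), which is an analytic function of the
𝔤ᶜ-valued small field B̃′, satisfying the bound |B′_Λ(B̃′)| ≦ 4d(100M)⁵γ₀⁻¹B₃²|B̃′|. (1.41)"* — PROVED at the abstract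
Banach-space level of the tree's model of (1.12)/(1.13)/(1.40) (`…B16Eq112`, `…B16Prop1IVAssembly`,
`…B16Sect1AnalyticExt.eq140_iff`), now over `ℂ` (SKELETON rows **B16.Eq1.41**, B16.Eq1.40; Phase 2 of the
mega-formalization `lit-balaban`, reader/typer block r13 gen 10; HOME `run/shared/lean/pub/lit-balaban/`, rows
`lit-balaban-r13/ROWS-B16.md`)

statement-level skeleton of published theorems with citation tags; proofs where landed; nothing here is a claim about
the Yang–Mills mass gap

PDF held: `paper:balaban1989-cmp122-large-field-ii` (journal page = PDF page + 354); p. 367 [PDF 13] READ AS AN IMAGE by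
this seat on the x2 render `run/shared/lean/pub/pub-balaban/b2b-balaban-ref1/pages/1989-cmp122-large-field-II/…-p013-x2.png`;
p. 359 [PDF 5] (the model of the contraction scheme) on `…-p005-x2.png` (r13 gens 1/3/6).

WHAT IS PRINTED (p. 367, verbatim).  *"Differentiating it with respect to B′, using the criticality condition for U₀ =
U_{k,Z}(V, V_Λ(V)), and inverting the linear operator as in (1.13), we obtain the equation
B′ + (P₀H*_{1,k}Δ₁H_{1,k}P₀)⁻¹P₀H*_{1,k}((δ/δA)V)(H_{1,k}B′ + H_{1,k}B̃′) = −(P₀H*_{1,k}Δ₁H_{1,k}P₀)⁻¹P₀H*_{1,k}Δ₁H_{1,k}B̃′.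
(1.40)  The notation above is a bit simplified … We can prove again that Eq. (1.40) has exactly one solution B′_Λ(B̃′),
which is an analytic function of the 𝔤ᶜ-valued small field B̃′, satisfying the bound |B′_Λ(B̃′)| ≦ 4d(100M)⁵γ₀⁻¹B₃²|B̃′|.
(1.41)"*  "again" = as on p. 359 for (1.13): *"Using Proposition 4 [15] and the fixed point theorem for contractive
mappings, we can easily prove that the above equation has exactly one solution, which has a bound equal to twice a bound
of the right-hand side of the equation"*, the inverse `(P₀H*Δ₁HP₀)⁻¹` being *"bounded by γ₀⁻¹2d(100M)⁵"* (p. 359, from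
(1.9)).  Print displays no proof of the analyticity.

THE MODEL (as in `…B16Prop1IVAssembly`, r13 gen 6, with `ℂ` for `ℝ` since B̃′ is 𝔤ᶜ-valued): `E` = a complex Banach space
of (𝔤ᶜ-valued) fields `B′`, `B̃′` on `Λ`; `F` = a complex normed space of fields on `T_η` (the arguments of `(δ/δA)V`);
bounded `ℂ`-linear `P₀ : E → E` (gauge projection), `H = H_{1,k} : E → F`, `Hst = H*_{1,k} : F → E`, `Δ₁ = Δ₁(ζ₀ = 1) :
F → F`, `Kinv = (P₀H*Δ₁HP₀)⁻¹ : E → E`; `dV = (δ/δA)V : F → F`.  (1.40) is the fixed-point equation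
`B′ + Kinv P₀ Hst (dV (H B′ + H B̃′)) = −Kinv P₀ Hst (Δ₁ (H B̃′))` — literally the right-hand member of
`B16Sect1AnalyticExt.eq140_iff` (there over `ℝ`).  The printed inputs become: `‖Kinv P₀ Hst z‖ ≦ κ₁‖z‖` (`κ₁ =
2d(100M)⁵γ₀⁻¹`, p. 359), `‖H x‖ ≦ h₁‖x‖`, `‖Δ₁ (H x)‖ ≦ b‖x‖` (`b = B₃²` in (1.41)), `dV 0 = 0` and `dV` `ℓ`-Lipschitz on
the ball `‖u‖ ≦ ρ` of `F` (*"Proposition 4 [15]"* = [Balaban1985Variational] Prop. 4: `V` is of third order, so `ℓ` is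
small for small fields), with the smallness `κ₁ℓh₁ ≦ ½`, `ℓh₁(2κ₁b + 1) ≦ b` and the room `h₁(2κ₁b + 2)r ≦ ρ` for `B̃′`
in the ball of radius `r`; for the analyticity: `dV` analytic (`ℂ`) on `‖u‖ < ρ`.

WHAT IS HERE (every `theorem` PROVED; theorems only; no `sorry`, no axiom, no `… : Prop` fact).
* `exists_solution140` — for `‖B̃′‖ ≦ r`: a solution `B′` of (1.40) with **`‖B′‖ ≦ 2κ₁b‖B̃′‖`** (contraction on the
  closed ball of radius `2κ₁b‖B̃′‖` = *"twice a bound of the right-hand side"*).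
* `solution140_unique` — *"exactly one"*: two solutions in the ball `‖B′‖ ≦ (2κ₁b + 1)r` coincide.
* **`exists_analytic_solution140`** — *"which is an analytic function of the 𝔤ᶜ-valued small field B̃′"*: a map
  `B̃′ ↦ B′_Λ(B̃′)`, `ℂ`-ANALYTIC on the open ball `‖B̃′‖ < r` (`AnalyticOnNhd`), solving (1.40) with `‖B′_Λ(B̃′)‖ ≦
  2κ₁b‖B̃′‖` there.  PROOF (the standard one, as `…B8Eq1117Analytic` does for B8 (1.117)): at `(B̃′₀, B′₀)` the map
  `Φ(B̃′, B′) = B′ + Kinv P₀ Hst dV(H B′ + H B̃′) + Kinv P₀ Hst Δ₁ H B̃′` is analytic and `∂_{B′}Φ = I + Kinv P₀ Hst ∘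
  D(dV) ∘ H` is invertible (`‖D(dV)‖ ≦ ℓ` by the converse mean value inequality, `κ₁ℓh₁ ≦ ½ < 1`, Neumann series);
  Mathlib's analytic implicit function theorem (`ContDiffAt.implicitFunction`, `n = ω`) gives an analytic local solution
  through `B′₀`, which stays in the uniqueness ball (`‖B′₀‖ ≦ 2κ₁b‖B̃′₀‖ < (2κ₁b + 1)r`) and therefore IS `B′_Λ` near `B̃′₀`.
* **`ineq141_of_solution`** — the row AS TYPED: with `κ₁ = 2d(100M)⁵γ₀⁻¹` and `b = B₃²`, every such solution satisfies
  `B16Sect1Statements.Ineq141 ‖B′‖ ‖B̃′‖ d M γ₀ B₃` (`B16Sect1Statements.ineq141_of_twice` BY NAME); `exactlyOne141` —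
  existence ∧ uniqueness ∧ (1.41) in one statement.
NOT HERE: the operators `H_{1,k,Z}`, `Δ₁`, the functional `V` and Proposition 4 [15] themselves (abstract data and
hypotheses, cell DIVERGENCE "schematic typing"), the derivation of (1.40) from (1.39) (row B16.Eq1.40,
`B16Sect1AnalyticExt.eq140_iff`), (1.42)–(1.45).  Nothing printed is asserted as a fact.
-/

noncomputable section

namespace Literature.MathematicalPhysics.QuantumFieldTheory.Balaban1983to89.B16Ineq141Solution

open Metric Filter
open scoped Topology ContDiff

variable {E F : Type*} [NormedAddCommGroup E] [NormedSpace ℂ E] [CompleteSpace E]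
  [NormedAddCommGroup F] [NormedSpace ℂ F]

/-! ## §1. Two pieces of plumbing: Banach's fixed point on a closed ball; `I + T` invertible for `‖T‖ < 1` -/

omit [NormedSpace ℂ E] in
/-- Banach's fixed point theorem on the closed ball `‖x‖ ≦ R`: a self-map of the ball which is ½-Lipschitz there has
a fixed point in the ball (Mathlib `ContractingWith.fixedPoint` on the complete subtype; the scheme of
`B16Sect1Kernels.fixedPoint_twice_bound`, here with a general radius). [folklore] -/
private theorem exists_fixedPoint_closedBall (T : E → E) {R : ℝ} (hR : 0 ≤ R)
    (hmaps : ∀ x : E, ‖x‖ ≤ R → ‖T x‖ ≤ R)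
    (hcontr : ∀ x y : E, ‖x‖ ≤ R → ‖y‖ ≤ R → ‖T x - T y‖ ≤ 1 / 2 * ‖x - y‖) :
    ∃ x : E, ‖x‖ ≤ R ∧ T x = x := by
  let S : Set E := Metric.closedBall 0 R
  have hmem : ∀ {x : E}, x ∈ S ↔ ‖x‖ ≤ R := fun {x} => by
    simp only [S, Metric.mem_closedBall, dist_zero_right]
  haveI : CompleteSpace S := Metric.isClosed_closedBall.completeSpace_coe
  haveI : Nonempty S := ⟨⟨0, hmem.2 (by rw [norm_zero]; exact hR)⟩⟩
  let g : S → S := fun x => ⟨T x, hmem.2 (hmaps x (hmem.1 x.2))⟩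
  have hg : ContractingWith (1 / 2) g := by
    refine ⟨by rw [← NNReal.coe_lt_coe]; push_cast; norm_num, LipschitzWith.of_dist_le_mul fun x y => ?_⟩
    rw [Subtype.dist_eq, Subtype.dist_eq, dist_eq_norm, dist_eq_norm]
    push_cast
    exact hcontr x y (hmem.1 x.2) (hmem.1 y.2)
  refine ⟨(ContractingWith.fixedPoint g hg : S), hmem.1 (ContractingWith.fixedPoint g hg).2, ?_⟩
  exact congrArg Subtype.val hg.fixedPoint_isFixedPt

/-- `I + T` is an invertible bounded operator when `‖T‖ < 1` (Neumann series, `Units.oneSub`). [folklore] -/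
private theorem isInvertible_id_add {T : E →L[ℂ] E} (hT : ‖T‖ < 1) :
    (ContinuousLinearMap.id ℂ E + T).IsInvertible := by
  have hT' : ‖-T‖ < 1 := by rwa [norm_neg]
  have hval : ((Units.oneSub (-T) hT' : (E →L[ℂ] E)ˣ) : E →L[ℂ] E) = ContinuousLinearMap.id ℂ E + T := by
    rw [Units.val_oneSub, sub_neg_eq_add]; rfl
  refine ContinuousLinearMap.IsInvertible.of_inverse (g := ((Units.oneSub (-T) hT')⁻¹ : (E →L[ℂ] E)ˣ)) ?_ ?_
  · have h := (Units.oneSub (-T) hT').mul_inv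
    rwa [ContinuousLinearMap.mul_def, ContinuousLinearMap.one_def, hval] at h
  · have h := (Units.oneSub (-T) hT').inv_mul
    rwa [ContinuousLinearMap.mul_def, ContinuousLinearMap.one_def, hval] at h

/-! ## §2. (1.40) has a solution with *"a bound equal to twice a bound of the right-hand side"*, and exactly one -/

omit [CompleteSpace E] in
/-- Norm bookkeeping for the argument of `(δ/δA)V` in (1.40): `‖H B′ + H B̃′‖ ≦ h₁(‖B′‖ + ‖B̃′‖)`. [cite: Balaban1989LargeFieldII, (1.40) p.367] -/
theorem norm_arg140_le (H : E →L[ℂ] F) {h₁ : ℝ} (hH : ∀ x : E, ‖H x‖ ≤ h₁ * ‖x‖) (x Bt : E) :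
    ‖H x + H Bt‖ ≤ h₁ * (‖x‖ + ‖Bt‖) := by
  calc ‖H x + H Bt‖ ≤ ‖H x‖ + ‖H Bt‖ := norm_add_le _ _
    _ ≤ h₁ * ‖x‖ + h₁ * ‖Bt‖ := add_le_add (hH x) (hH Bt)
    _ = h₁ * (‖x‖ + ‖Bt‖) := by ring

/-- **(1.40)–(1.41) p. 367 [PDF 13], existence with the printed bound** (render p013): in the model of the module
docstring, for `‖B̃′‖ ≦ r`, Eq. (1.40) `B′ + Kinv P₀ Hst (dV (H B′ + H B̃′)) = −Kinv P₀ Hst (Δ₁ (H B̃′))` has a solution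
with `‖B′‖ ≦ 2κ₁b‖B̃′‖` — *"twice a bound of the right-hand side"* (`‖Kinv P₀ Hst Δ₁ H B̃′‖ ≦ κ₁b‖B̃′‖`) — by the fixed
point theorem for contractive mappings on the closed ball of that radius, the contraction being supplied by the Lipschitz
constant `ℓ` of `dV` on `‖u‖ ≦ ρ` (*"Proposition 4 [15]"*) with `κ₁ℓh₁ ≦ ½`, `ℓh₁(2κ₁b + 1) ≦ b`, `h₁(2κ₁b + 2)r ≦ ρ`.
PROVED. [cite: Balaban1989LargeFieldII, (1.40)–(1.41) p.367] -/
theorem exists_solution140 (P₀ Kinv : E →L[ℂ] E) (H : E →L[ℂ] F) (Hst : F →L[ℂ] E) (Δ₁ : F →L[ℂ] F) (dV : F → F)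
    {κ₁ h₁ b ℓ ρ r : ℝ} (hκ₁ : 0 ≤ κ₁) (hh₁ : 0 ≤ h₁) (hb : 0 ≤ b) (hℓ : 0 ≤ ℓ)
    (hKop : ∀ z : F, ‖Kinv (P₀ (Hst z))‖ ≤ κ₁ * ‖z‖) (hH : ∀ x : E, ‖H x‖ ≤ h₁ * ‖x‖)
    (hΔ : ∀ x : E, ‖Δ₁ (H x)‖ ≤ b * ‖x‖) (hdV0 : dV 0 = 0)
    (hdV : ∀ u v : F, ‖u‖ ≤ ρ → ‖v‖ ≤ ρ → ‖dV u - dV v‖ ≤ ℓ * ‖u - v‖)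
    (hρ : h₁ * ((2 * κ₁ * b + 2) * r) ≤ ρ) (hsm1 : κ₁ * ℓ * h₁ ≤ 1 / 2) (hsm2 : ℓ * h₁ * (2 * κ₁ * b + 1) ≤ b)
    {Bt : E} (hBt : ‖Bt‖ ≤ r) :
    ∃ x : E, ‖x‖ ≤ 2 * κ₁ * b * ‖Bt‖ ∧
      x + Kinv (P₀ (Hst (dV (H x + H Bt)))) = -(Kinv (P₀ (Hst (Δ₁ (H Bt))))) := by
  set R : ℝ := 2 * κ₁ * b * ‖Bt‖ with hR
  have hR0 : 0 ≤ R := by rw [hR]; positivity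
  have hr0 : 0 ≤ r := (norm_nonneg Bt).trans hBt
  have hρ0 : 0 ≤ ρ := le_trans (by positivity) hρ
  -- the argument H x + H B̃′ stays in the Lipschitz ball when ‖x‖ ≤ R
  have hκb : 0 ≤ κ₁ * b := mul_nonneg hκ₁ hb
  have hκbBt : κ₁ * b * ‖Bt‖ ≤ κ₁ * b * r := mul_le_mul_of_nonneg_left hBt hκb
  have harg : ∀ x : E, ‖x‖ ≤ R → ‖H x + H Bt‖ ≤ ρ := by
    intro x hx
    rw [hR] at hx
    have h1 := norm_arg140_le H hH x Bt
    have hsum : ‖x‖ + ‖Bt‖ ≤ (2 * κ₁ * b + 2) * r := by nlinarith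
    have h2 : h₁ * (‖x‖ + ‖Bt‖) ≤ h₁ * ((2 * κ₁ * b + 2) * r) := mul_le_mul_of_nonneg_left hsum hh₁
    linarith
  -- the fixed-point map of (1.40)
  set T : E → E := fun x => -(Kinv (P₀ (Hst (Δ₁ (H Bt))))) - Kinv (P₀ (Hst (dV (H x + H Bt)))) with hT
  have hc : ‖Kinv (P₀ (Hst (Δ₁ (H Bt))))‖ ≤ κ₁ * b * ‖Bt‖ := by
    calc ‖Kinv (P₀ (Hst (Δ₁ (H Bt))))‖ ≤ κ₁ * ‖Δ₁ (H Bt)‖ := hKop _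
      _ ≤ κ₁ * (b * ‖Bt‖) := mul_le_mul_of_nonneg_left (hΔ Bt) hκ₁
      _ = κ₁ * b * ‖Bt‖ := by ring
  have hmaps : ∀ x : E, ‖x‖ ≤ R → ‖T x‖ ≤ R := by
    intro x hx
    have hK : ‖Kinv (P₀ (Hst (dV (H x + H Bt))))‖ ≤ κ₁ * (ℓ * (h₁ * ((2 * κ₁ * b + 1) * ‖Bt‖))) := by
      have h1 : ‖dV (H x + H Bt)‖ ≤ ℓ * ‖H x + H Bt‖ := by
        have := hdV (H x + H Bt) 0 (harg x hx) (by rw [norm_zero]; exact hρ0)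
        rwa [hdV0, sub_zero, sub_zero] at this
      have h2 : ‖H x + H Bt‖ ≤ h₁ * ((2 * κ₁ * b + 1) * ‖Bt‖) := by
        refine (norm_arg140_le H hH x Bt).trans (mul_le_mul_of_nonneg_left ?_ hh₁)
        rw [hR] at hx
        linarith
      calc ‖Kinv (P₀ (Hst (dV (H x + H Bt))))‖ ≤ κ₁ * ‖dV (H x + H Bt)‖ := hKop _
        _ ≤ κ₁ * (ℓ * (h₁ * ((2 * κ₁ * b + 1) * ‖Bt‖))) :=
            mul_le_mul_of_nonneg_left (h1.trans (mul_le_mul_of_nonneg_left h2 hℓ)) hκ₁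
    have hBt0 : 0 ≤ ‖Bt‖ := norm_nonneg Bt
    calc ‖T x‖ ≤ ‖-(Kinv (P₀ (Hst (Δ₁ (H Bt)))))‖ + ‖Kinv (P₀ (Hst (dV (H x + H Bt))))‖ := norm_sub_le _ _
      _ ≤ κ₁ * b * ‖Bt‖ + κ₁ * (ℓ * (h₁ * ((2 * κ₁ * b + 1) * ‖Bt‖))) := by
          rw [norm_neg]; exact add_le_add hc hK
      _ = κ₁ * ‖Bt‖ * (b + ℓ * h₁ * (2 * κ₁ * b + 1)) := by ring
      _ ≤ κ₁ * ‖Bt‖ * (b + b) := mul_le_mul_of_nonneg_left (by linarith) (by positivity)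
      _ = R := by rw [hR]; ring
  have hcontr : ∀ x y : E, ‖x‖ ≤ R → ‖y‖ ≤ R → ‖T x - T y‖ ≤ 1 / 2 * ‖x - y‖ := by
    intro x y hx hy
    have e : T x - T y = -(Kinv (P₀ (Hst (dV (H x + H Bt) - dV (H y + H Bt))))) := by
      simp only [hT, map_sub]; abel
    rw [e, norm_neg]
    have h1 : ‖dV (H x + H Bt) - dV (H y + H Bt)‖ ≤ ℓ * ‖(H x + H Bt) - (H y + H Bt)‖ :=
      hdV _ _ (harg x hx) (harg y hy)
    have h2 : ‖(H x + H Bt) - (H y + H Bt)‖ ≤ h₁ * ‖x - y‖ := by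
      have : (H x + H Bt) - (H y + H Bt) = H (x - y) := by rw [map_sub]; abel
      rw [this]; exact hH _
    calc ‖Kinv (P₀ (Hst (dV (H x + H Bt) - dV (H y + H Bt))))‖
        ≤ κ₁ * ‖dV (H x + H Bt) - dV (H y + H Bt)‖ := hKop _
      _ ≤ κ₁ * (ℓ * (h₁ * ‖x - y‖)) :=
          mul_le_mul_of_nonneg_left (h1.trans (mul_le_mul_of_nonneg_left h2 hℓ)) hκ₁
      _ = (κ₁ * ℓ * h₁) * ‖x - y‖ := by ring
      _ ≤ 1 / 2 * ‖x - y‖ := mul_le_mul_of_nonneg_right hsm1 (norm_nonneg _)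
  obtain ⟨x, hxR, hfix⟩ := exists_fixedPoint_closedBall T hR0 hmaps hcontr
  refine ⟨x, hxR, ?_⟩
  have hfix' : -(Kinv (P₀ (Hst (Δ₁ (H Bt))))) - Kinv (P₀ (Hst (dV (H x + H Bt)))) = x := hfix
  have h1 : x + Kinv (P₀ (Hst (dV (H x + H Bt)))) =
      (-(Kinv (P₀ (Hst (Δ₁ (H Bt))))) - Kinv (P₀ (Hst (dV (H x + H Bt))))) +
        Kinv (P₀ (Hst (dV (H x + H Bt)))) := by rw [hfix']
  rw [h1]
  abel

omit [CompleteSpace E] in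
/-- **"exactly one solution"** p. 367 [PDF 13] — uniqueness half: for `‖B̃′‖ ≦ r`, two solutions of (1.40) in the ball
`‖B′‖ ≦ (2κ₁b + 1)r` coincide (their difference is `Kinv P₀ Hst` of a difference of values of `dV`, of norm at most
`κ₁ℓh₁ ≦ ½` times itself). PROVED. [cite: Balaban1989LargeFieldII, (1.40)–(1.41) p.367] -/
theorem solution140_unique (P₀ Kinv : E →L[ℂ] E) (H : E →L[ℂ] F) (Hst : F →L[ℂ] E) (Δ₁ : F →L[ℂ] F) (dV : F → F)
    {κ₁ h₁ b ℓ ρ r : ℝ} (hκ₁ : 0 ≤ κ₁) (hh₁ : 0 ≤ h₁) (hℓ : 0 ≤ ℓ)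
    (hKop : ∀ z : F, ‖Kinv (P₀ (Hst z))‖ ≤ κ₁ * ‖z‖) (hH : ∀ x : E, ‖H x‖ ≤ h₁ * ‖x‖)
    (hdV : ∀ u v : F, ‖u‖ ≤ ρ → ‖v‖ ≤ ρ → ‖dV u - dV v‖ ≤ ℓ * ‖u - v‖)
    (hρ : h₁ * ((2 * κ₁ * b + 2) * r) ≤ ρ) (hsm1 : κ₁ * ℓ * h₁ ≤ 1 / 2)
    {Bt : E} (hBt : ‖Bt‖ ≤ r) {x y : E} (hx : ‖x‖ ≤ (2 * κ₁ * b + 1) * r) (hy : ‖y‖ ≤ (2 * κ₁ * b + 1) * r)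
    (hxe : x + Kinv (P₀ (Hst (dV (H x + H Bt)))) = -(Kinv (P₀ (Hst (Δ₁ (H Bt))))))
    (hye : y + Kinv (P₀ (Hst (dV (H y + H Bt)))) = -(Kinv (P₀ (Hst (Δ₁ (H Bt)))))) : x = y := by
  have harg : ∀ z : E, ‖z‖ ≤ (2 * κ₁ * b + 1) * r → ‖H z + H Bt‖ ≤ ρ := by
    intro z hz
    have h1 := norm_arg140_le H hH z Bt
    have h2 : h₁ * (‖z‖ + ‖Bt‖) ≤ h₁ * ((2 * κ₁ * b + 2) * r) :=
      mul_le_mul_of_nonneg_left (by linarith) hh₁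
    linarith
  have e : x - y = -(Kinv (P₀ (Hst (dV (H x + H Bt)))) - Kinv (P₀ (Hst (dV (H y + H Bt))))) := by
    have h : x + Kinv (P₀ (Hst (dV (H x + H Bt)))) - (y + Kinv (P₀ (Hst (dV (H y + H Bt))))) = 0 := by
      rw [hxe, hye, sub_self]
    have h' : x - y + (Kinv (P₀ (Hst (dV (H x + H Bt)))) - Kinv (P₀ (Hst (dV (H y + H Bt))))) = 0 := by
      rw [← h]; abel
    exact eq_neg_of_add_eq_zero_left h'
  have h1 : ‖dV (H x + H Bt) - dV (H y + H Bt)‖ ≤ ℓ * ‖(H x + H Bt) - (H y + H Bt)‖ :=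
    hdV _ _ (harg x hx) (harg y hy)
  have h2 : ‖(H x + H Bt) - (H y + H Bt)‖ ≤ h₁ * ‖x - y‖ := by
    have : (H x + H Bt) - (H y + H Bt) = H (x - y) := by rw [map_sub]; abel
    rw [this]; exact hH _
  have h3 : ‖x - y‖ ≤ 1 / 2 * ‖x - y‖ := by
    calc ‖x - y‖ = ‖Kinv (P₀ (Hst (dV (H x + H Bt) - dV (H y + H Bt))))‖ := by
          rw [e, norm_neg]; simp only [map_sub]
      _ ≤ κ₁ * ‖dV (H x + H Bt) - dV (H y + H Bt)‖ := hKop _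
      _ ≤ κ₁ * (ℓ * (h₁ * ‖x - y‖)) :=
          mul_le_mul_of_nonneg_left (h1.trans (mul_le_mul_of_nonneg_left h2 hℓ)) hκ₁
      _ = (κ₁ * ℓ * h₁) * ‖x - y‖ := by ring
      _ ≤ 1 / 2 * ‖x - y‖ := mul_le_mul_of_nonneg_right hsm1 (norm_nonneg _)
  have h4 : ‖x - y‖ = 0 := le_antisymm (by linarith [norm_nonneg (x - y)]) (norm_nonneg _)
  exact sub_eq_zero.mp (norm_eq_zero.mp h4)

/-! ## §3. *"which is an analytic function of the 𝔤ᶜ-valued small field B̃′"* -/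

/-- **p. 367 [PDF 13], verbatim: *"Eq. (1.40) has exactly one solution B′_Λ(B̃′), which is an analytic function of
the 𝔤ᶜ-valued small field B̃′, satisfying the bound (1.41)"*** — in the model of the module docstring, with `dV`
moreover `ℂ`-analytic on the open ball `‖u‖ < ρ` (`0 < ρ`): there is a map `B̃′ ↦ B′_Λ(B̃′)`, `ℂ`-ANALYTIC on the
open ball `‖B̃′‖ < r` (`AnalyticOnNhd`), such that for every `‖B̃′‖ < r` the value `B′_Λ(B̃′)` solves (1.40) and
`‖B′_Λ(B̃′)‖ ≦ 2κ₁b‖B̃′‖`.  PROOF: `B′_Λ` = the solution of `exists_solution140`; at each `B̃′₀` the analytic implicit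
function theorem (Mathlib `ContDiffAt.implicitFunction`, `n = ω`; `∂_{B′}Φ = I + Kinv P₀ Hst ∘ D(dV) ∘ H` invertible by
`‖D(dV)‖ ≦ ℓ`, `κ₁ℓh₁ ≦ ½` and the Neumann series) gives an analytic local solution through `B′_Λ(B̃′₀)`, equal to `B′_Λ`
near `B̃′₀` by `solution140_unique`. [cite: Balaban1989LargeFieldII, (1.40)–(1.41) p.367] -/
theorem exists_analytic_solution140 (P₀ Kinv : E →L[ℂ] E) (H : E →L[ℂ] F) (Hst : F →L[ℂ] E) (Δ₁ : F →L[ℂ] F)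
    (dV : F → F) {κ₁ h₁ b ℓ ρ r : ℝ} (hκ₁ : 0 ≤ κ₁) (hh₁ : 0 ≤ h₁) (hb : 0 ≤ b) (hℓ : 0 ≤ ℓ) (hρ0 : 0 < ρ)
    (hKop : ∀ z : F, ‖Kinv (P₀ (Hst z))‖ ≤ κ₁ * ‖z‖) (hH : ∀ x : E, ‖H x‖ ≤ h₁ * ‖x‖)
    (hΔ : ∀ x : E, ‖Δ₁ (H x)‖ ≤ b * ‖x‖) (hdV0 : dV 0 = 0)
    (hdV : ∀ u v : F, ‖u‖ ≤ ρ → ‖v‖ ≤ ρ → ‖dV u - dV v‖ ≤ ℓ * ‖u - v‖)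
    (hA : ∀ u : F, ‖u‖ < ρ → AnalyticAt ℂ dV u)
    (hρ : h₁ * ((2 * κ₁ * b + 2) * r) ≤ ρ) (hsm1 : κ₁ * ℓ * h₁ ≤ 1 / 2) (hsm2 : ℓ * h₁ * (2 * κ₁ * b + 1) ≤ b) :
    ∃ sol : E → E, AnalyticOnNhd ℂ sol (ball (0 : E) r) ∧
      ∀ Bt : E, ‖Bt‖ < r → ‖sol Bt‖ ≤ 2 * κ₁ * b * ‖Bt‖ ∧
        sol Bt + Kinv (P₀ (Hst (dV (H (sol Bt) + H Bt)))) = -(Kinv (P₀ (Hst (Δ₁ (H Bt))))) := by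
  classical
  -- the solution map: the solution of `exists_solution140` inside the closed ball, 0 outside
  have hex : ∀ Bt : E, ‖Bt‖ ≤ r → ∃ x : E, ‖x‖ ≤ 2 * κ₁ * b * ‖Bt‖ ∧
      x + Kinv (P₀ (Hst (dV (H x + H Bt)))) = -(Kinv (P₀ (Hst (Δ₁ (H Bt))))) := fun Bt hBt =>
    exists_solution140 P₀ Kinv H Hst Δ₁ dV hκ₁ hh₁ hb hℓ hKop hH hΔ hdV0 hdV hρ hsm1 hsm2 hBt
  let sol : E → E := fun Bt => if h : ‖Bt‖ ≤ r then Classical.choose (hex Bt h) else 0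
  have hsol : ∀ Bt : E, ‖Bt‖ ≤ r → ‖sol Bt‖ ≤ 2 * κ₁ * b * ‖Bt‖ ∧
      sol Bt + Kinv (P₀ (Hst (dV (H (sol Bt) + H Bt)))) = -(Kinv (P₀ (Hst (Δ₁ (H Bt))))) := by
    intro Bt hBt
    have e : sol Bt = Classical.choose (hex Bt hBt) := by simp only [sol, dif_pos hBt]
    rw [e]
    exact Classical.choose_spec (hex Bt hBt)
  refine ⟨sol, ?_, fun Bt hBt => hsol Bt hBt.le⟩
  -- analyticity at every point of the open ball
  intro Bt₀ hBt₀m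
  have hBt₀ : ‖Bt₀‖ < r := mem_ball_zero_iff.mp hBt₀m
  have hr : 0 < r := lt_of_le_of_lt (norm_nonneg _) hBt₀
  obtain ⟨hx₀n, hx₀e⟩ := hsol Bt₀ hBt₀.le
  set x₀ : E := sol Bt₀ with hx₀
  -- x₀ lies strictly inside the uniqueness ball
  have hx₀_lt : ‖x₀‖ < (2 * κ₁ * b + 1) * r := by
    have h1 : 2 * κ₁ * b * ‖Bt₀‖ ≤ 2 * κ₁ * b * r := mul_le_mul_of_nonneg_left hBt₀.le (by positivity)
    nlinarith
  -- the base argument u₀ = H x₀ + H B̃′₀ lies in the open analyticity ball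
  have hu₀ : ‖H x₀ + H Bt₀‖ < ρ := by
    have h1 := norm_arg140_le H hH x₀ Bt₀
    have h2 : ‖x₀‖ + ‖Bt₀‖ < (2 * κ₁ * b + 2) * r := by nlinarith
    rcases eq_or_lt_of_le hh₁ with h0 | hpos
    · have : h₁ * (‖x₀‖ + ‖Bt₀‖) = 0 := by rw [← h0, zero_mul]
      linarith
    · have h3 : h₁ * (‖x₀‖ + ‖Bt₀‖) < h₁ * ((2 * κ₁ * b + 2) * r) := mul_lt_mul_of_pos_left h2 hpos
      linarith
  -- the implicit equation Φ(B̃′, B′) = B′ + Kinv P₀ Hst dV(H B′ + H B̃′) + Kinv P₀ Hst Δ₁ H B̃′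
  set KPH : F →L[ℂ] E := Kinv.comp (P₀.comp Hst) with hKPH
  have hKPH_apply : ∀ z : F, KPH z = Kinv (P₀ (Hst z)) := fun z => rfl
  set Lm : E × E →L[ℂ] F := H.comp (ContinuousLinearMap.snd ℂ E E) + H.comp (ContinuousLinearMap.fst ℂ E E)
    with hLm
  have hLm_apply : ∀ v : E × E, Lm v = H v.2 + H v.1 := fun v => rfl
  set Cst : E × E →L[ℂ] E := (KPH.comp (Δ₁.comp H)).comp (ContinuousLinearMap.fst ℂ E E) with hCst
  have hCst_apply : ∀ v : E × E, Cst v = Kinv (P₀ (Hst (Δ₁ (H v.1)))) := fun v => rfl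
  set Φ : E × E → E := fun v => v.2 + KPH (dV (Lm v)) + Cst v with hΦ
  have hΦ_apply : ∀ Bt x : E, Φ (Bt, x) = x + Kinv (P₀ (Hst (dV (H x + H Bt)))) + Kinv (P₀ (Hst (Δ₁ (H Bt)))) :=
    fun Bt x => rfl
  have hLm₀ : Lm (Bt₀, x₀) = H x₀ + H Bt₀ := rfl
  -- Φ is analytic at (B̃′₀, x₀)
  have hA₀ : AnalyticAt ℂ dV (Lm (Bt₀, x₀)) := by rw [hLm₀]; exact hA _ hu₀
  have hΦan : AnalyticAt ℂ Φ (Bt₀, x₀) :=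
    (analyticAt_snd.add ((KPH.analyticAt _).comp (hA₀.comp (Lm.analyticAt _)))).add (Cst.analyticAt _)
  have hΦcd : ContDiffAt ℂ ω Φ (Bt₀, x₀) := hΦan.contDiffAt
  -- the derivative of dV at u₀ and its norm ≤ ℓ (converse mean value inequality)
  set T₀ : F →L[ℂ] F := fderiv ℂ dV (Lm (Bt₀, x₀)) with hT₀
  have hdVd : HasFDerivAt dV T₀ (Lm (Bt₀, x₀)) := hA₀.differentiableAt.hasFDerivAt
  have hT₀_norm : ‖T₀‖ ≤ ℓ := by
    refine hdVd.le_of_lip' hℓ ?_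
    have hopen : IsOpen {u : F | ‖u‖ < ρ} := isOpen_lt continuous_norm continuous_const
    have hmem : {u : F | ‖u‖ < ρ} ∈ 𝓝 (Lm (Bt₀, x₀)) := hopen.mem_nhds (by rw [hLm₀]; exact hu₀)
    filter_upwards [hmem] with u hu
    exact hdV u _ hu.le (by rw [hLm₀]; exact hu₀.le)
  -- the derivative of Φ
  set Φ' : E × E →L[ℂ] E := ContinuousLinearMap.snd ℂ E E + KPH.comp (T₀.comp Lm) + Cst with hΦ'
  have hΦd : HasFDerivAt Φ Φ' (Bt₀, x₀) := by
    have h1 : HasFDerivAt (fun v : E × E => KPH (dV (Lm v))) (KPH.comp (T₀.comp Lm)) (Bt₀, x₀) :=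
      KPH.hasFDerivAt.comp (Bt₀, x₀) (hdVd.comp (Bt₀, x₀) Lm.hasFDerivAt)
    exact (hasFDerivAt_snd.add h1).add Cst.hasFDerivAt
  -- the partial derivative in B′ is I + Kinv P₀ Hst ∘ D(dV) ∘ H, invertible by the Neumann series
  have hpartial : Φ'.comp (ContinuousLinearMap.inr ℂ E E) =
      ContinuousLinearMap.id ℂ E + KPH.comp (T₀.comp H) := by
    ext x
    simp [hΦ', hLm, hCst]
  have hsmall : ‖KPH.comp (T₀.comp H)‖ < 1 := by
    have hbd : ∀ x : E, ‖(KPH.comp (T₀.comp H)) x‖ ≤ (κ₁ * ℓ * h₁) * ‖x‖ := by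
      intro x
      calc ‖(KPH.comp (T₀.comp H)) x‖ = ‖Kinv (P₀ (Hst (T₀ (H x))))‖ := rfl
        _ ≤ κ₁ * ‖T₀ (H x)‖ := hKop _
        _ ≤ κ₁ * (ℓ * (h₁ * ‖x‖)) := by
            refine mul_le_mul_of_nonneg_left ?_ hκ₁
            exact (T₀.le_opNorm _).trans (mul_le_mul hT₀_norm (hH x) (norm_nonneg _) hℓ)
        _ = (κ₁ * ℓ * h₁) * ‖x‖ := by ring
    have hop : ‖KPH.comp (T₀.comp H)‖ ≤ κ₁ * ℓ * h₁ :=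
      ContinuousLinearMap.opNorm_le_bound _ (by positivity) hbd
    linarith
  have hinv : (fderiv ℂ Φ (Bt₀, x₀) ∘L ContinuousLinearMap.inr ℂ E E).IsInvertible := by
    rw [hΦd.fderiv, hpartial]; exact isInvertible_id_add hsmall
  -- the analytic implicit function ψ near B̃′₀
  have hω : (ω : ℕ∞ω) ≠ 0 := by simp
  have hψ₀ : hΦcd.implicitFunction hω hinv Bt₀ = x₀ := hΦcd.implicitFunction_apply_self hω hinv
  have hψcd : ContDiffAt ℂ ω (hΦcd.implicitFunction hω hinv) Bt₀ := hΦcd.contDiffAt_implicitFunction hω hinv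
  have hψeq : ∀ᶠ Bt in 𝓝 Bt₀, Φ (Bt, hΦcd.implicitFunction hω hinv Bt) = Φ (Bt₀, x₀) :=
    hΦcd.eventually_apply_implicitFunction hω hinv
  have hΦ₀ : Φ (Bt₀, x₀) = 0 := by
    rw [hΦ_apply, hx₀e, neg_add_cancel]
  -- ψ stays inside the uniqueness ball and B̃′ inside the small-field ball, near B̃′₀
  have hψball : ∀ᶠ Bt in 𝓝 Bt₀, ‖hΦcd.implicitFunction hω hinv Bt‖ < (2 * κ₁ * b + 1) * r := by
    have hc : ContinuousAt (hΦcd.implicitFunction hω hinv) Bt₀ := hψcd.continuousAt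
    have hopen : IsOpen {y : E | ‖y‖ < (2 * κ₁ * b + 1) * r} := isOpen_lt continuous_norm continuous_const
    exact hc.preimage_mem_nhds (hopen.mem_nhds (by rw [Set.mem_setOf_eq, hψ₀]; exact hx₀_lt))
  have hBtball : ∀ᶠ Bt in 𝓝 Bt₀, ‖Bt‖ < r := (isOpen_lt continuous_norm continuous_const).mem_nhds hBt₀
  -- hence sol = ψ near B̃′₀ by "exactly one solution"
  have hEq : sol =ᶠ[𝓝 Bt₀] hΦcd.implicitFunction hω hinv := by
    filter_upwards [hψeq, hψball, hBtball] with Bt hBt hBtb hBtr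
    obtain ⟨hsn, hse⟩ := hsol Bt hBtr.le
    have hψe : hΦcd.implicitFunction hω hinv Bt +
        Kinv (P₀ (Hst (dV (H (hΦcd.implicitFunction hω hinv Bt) + H Bt)))) =
          -(Kinv (P₀ (Hst (Δ₁ (H Bt))))) := by
      rw [hΦ₀, hΦ_apply] at hBt
      exact eq_neg_of_add_eq_zero_left hBt
    have hsn' : ‖sol Bt‖ ≤ (2 * κ₁ * b + 1) * r := by
      have h1 : 2 * κ₁ * b * ‖Bt‖ ≤ 2 * κ₁ * b * r := mul_le_mul_of_nonneg_left hBtr.le (by positivity)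
      nlinarith
    exact solution140_unique P₀ Kinv H Hst Δ₁ dV hκ₁ hh₁ hℓ hKop hH hdV hρ hsm1 hBtr.le hsn' hBtb.le hse hψe
  exact (hψcd.congr_of_eventuallyEq hEq).analyticAt

/-! ## §4. The row AS TYPED: (1.41) with `κ₁ = 2d(100M)⁵γ₀⁻¹`, `b = B₃²` -/

omit [NormedSpace ℂ E] [CompleteSpace E] in
/-- **(1.41) AS TYPED** (`B16Sect1Statements.Ineq141 |B′_Λ(B̃′)| |B̃′| d M γ₀ B₃` = `|B′_Λ(B̃′)| ≦ 4d(100M)⁵γ₀⁻¹B₃²|B̃′|`):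
any `B′` with the bound `‖B′‖ ≦ 2κ₁b‖B̃′‖` of `exists_solution140`, the inverse bound `κ₁ = 2d(100M)⁵γ₀⁻¹` of p. 359
(from (1.9)) and `b = B₃²`, satisfies (1.41) — `B16Sect1Statements.ineq141_of_twice` BY NAME with the right-hand-side
bound `κ₁B₃²‖B̃′‖`. PROVED. [cite: Balaban1989LargeFieldII, (1.41) p.367] -/
theorem ineq141_of_solution {x Bt : E} {κ₁ b M γ₀ B₃ : ℝ} {d : ℕ} (hx : ‖x‖ ≤ 2 * κ₁ * b * ‖Bt‖)
    (hκ₁ : κ₁ = 2 * d * (100 * M) ^ 5 * γ₀⁻¹) (hb : b = B₃ ^ 2) :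
    B16Sect1Statements.Ineq141 ‖x‖ ‖Bt‖ d M γ₀ B₃ := by
  refine B16Sect1Statements.ineq141_of_twice (nc := κ₁ * b * ‖Bt‖) (by linarith) ?_
  rw [hκ₁, hb]
  exact le_of_eq (by ring)

/-- **"Eq. (1.40) has exactly one solution B′_Λ(B̃′) … satisfying the bound (1.41)"** p. 367 [PDF 13], assembled: in
the model of the module docstring with `κ₁ = 2d(100M)⁵γ₀⁻¹`, `b = B₃²`, for every `‖B̃′‖ ≦ r` there is a solution `B′`
of (1.40) satisfying (1.41) AS TYPED (`B16Sect1Statements.Ineq141`), and any two solutions in the ball `‖B′‖ ≦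
(2κ₁B₃² + 1)r` coincide. PROVED (`exists_solution140`, `ineq141_of_solution`, `solution140_unique`). [cite: Balaban1989LargeFieldII, (1.40)–(1.41) p.367] -/
theorem exactlyOne141 (P₀ Kinv : E →L[ℂ] E) (H : E →L[ℂ] F) (Hst : F →L[ℂ] E) (Δ₁ : F →L[ℂ] F) (dV : F → F)
    {κ₁ h₁ b ℓ ρ r M γ₀ B₃ : ℝ} {d : ℕ} (hκ₁ : κ₁ = 2 * d * (100 * M) ^ 5 * γ₀⁻¹) (hb : b = B₃ ^ 2)
    (hκ₁0 : 0 ≤ κ₁) (hh₁ : 0 ≤ h₁) (hℓ : 0 ≤ ℓ)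
    (hKop : ∀ z : F, ‖Kinv (P₀ (Hst z))‖ ≤ κ₁ * ‖z‖) (hH : ∀ x : E, ‖H x‖ ≤ h₁ * ‖x‖)
    (hΔ : ∀ x : E, ‖Δ₁ (H x)‖ ≤ b * ‖x‖) (hdV0 : dV 0 = 0)
    (hdV : ∀ u v : F, ‖u‖ ≤ ρ → ‖v‖ ≤ ρ → ‖dV u - dV v‖ ≤ ℓ * ‖u - v‖)
    (hρ : h₁ * ((2 * κ₁ * b + 2) * r) ≤ ρ) (hsm1 : κ₁ * ℓ * h₁ ≤ 1 / 2) (hsm2 : ℓ * h₁ * (2 * κ₁ * b + 1) ≤ b)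
    {Bt : E} (hBt : ‖Bt‖ ≤ r) :
    (∃ x : E, B16Sect1Statements.Ineq141 ‖x‖ ‖Bt‖ d M γ₀ B₃ ∧ ‖x‖ ≤ 2 * κ₁ * b * ‖Bt‖ ∧
        x + Kinv (P₀ (Hst (dV (H x + H Bt)))) = -(Kinv (P₀ (Hst (Δ₁ (H Bt)))))) ∧
      ∀ x y : E, ‖x‖ ≤ (2 * κ₁ * b + 1) * r → ‖y‖ ≤ (2 * κ₁ * b + 1) * r →
        x + Kinv (P₀ (Hst (dV (H x + H Bt)))) = -(Kinv (P₀ (Hst (Δ₁ (H Bt))))) →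
        y + Kinv (P₀ (Hst (dV (H y + H Bt)))) = -(Kinv (P₀ (Hst (Δ₁ (H Bt))))) → x = y := by
  have hb0 : 0 ≤ b := by rw [hb]; positivity
  obtain ⟨x, hxn, hxe⟩ :=
    exists_solution140 P₀ Kinv H Hst Δ₁ dV hκ₁0 hh₁ hb0 hℓ hKop hH hΔ hdV0 hdV hρ hsm1 hsm2 hBt
  exact ⟨⟨x, ineq141_of_solution hxn hκ₁ hb, hxn, hxe⟩, fun x y hx hy hxe hye =>
    solution140_unique P₀ Kinv H Hst Δ₁ dV hκ₁0 hh₁ hℓ hKop hH hdV hρ hsm1 hBt hx hy hxe hye⟩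

end Literature.MathematicalPhysics.QuantumFieldTheory.Balaban1983to89.B16Ineq141Solution

end
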